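import Mathlib
import HarnessLib
import Literature.MathematicalPhysics.KineticTheory.HardSphereEulerProofs
import Summits.AtomisticToContinuum.HydrodynamicLimit.Theorems.OneFlightGossipEngineKineticCurrentsLDAlongFamiliesRadialTailDominator

/-!
# Statics of the split `F = F₁ + F₂` of an enlarged-class functional (helper file for
# `KCWUSharpPlus ⟸ KCWUSharp ∧ KCWUSharpRadial`; crux `KineticCurrentsLDAlongFamilies`,
# stmt-AtomisticToContinuum-16659, line `Sketch`, lead prover-line-…-16659-c3-0, cycle 4)

A functional of the enlarged class, `F(x,v) = A(x):w⊗w + (b(x)·w)G(x,|w|²) + K(x,|w|²)`, `w = v − u₀(x)`,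
of growth `C(1+‖v‖²)` and orthogonal to `1, v_j, ‖v‖²` under `M_x = M_{1,u₀(x),θ₀(x)}`, splits as
`F = F₁ + F₂` with

* `F₁ = A₀(x):w⊗w + (b(x)·w)G(x,|w|²)`, `A₀ = A − (tr A/3)·1` (traceless) — a member of the STRUCTURED class;
* `F₂ = K₂(x,|w|²)`, `K₂(x,ρ) = K(x,ρ) + (tr A(x)/3)·ρ` — a member of the RADIAL sector.

This file records the statics at ONE base point `(u, θ)`:

* `PlusOfParts.axis_values`, `PlusOfParts.radialProfile_eq` — the six axis values give
  `K(r²) + (tr A/3) r² = (1/6) Σ_j (F(u + r e_j) + F(u − r e_j))` (the odd part cancels in `±`, the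
  traceless part in the axis sum);
* `PlusOfParts.abs_radialProfile_le` — hence `|K(ρ) + (tr A/3)ρ| ≤ C(1 + 2U² + 2ρ)` from
  `|F(v)| ≤ C(1+‖v‖²)`, `‖u‖ ≤ U`;
* `PlusOfParts.maxwellian_orth_of_reduced`, `PlusOfParts.reduced_orth_of_maxwellian` — Maxwellian
  orthogonality to `1, v_j, ‖v‖²` versus `γ`-orthogonality to `1, ξ_j, ‖ξ‖²` in the reduced variable
  `v = u + √θ ξ`;
* `PlusOfParts.split_orth` — if `F = F₁ + k₂(‖· − u‖²)` with `F₁` a TRACELESS structured class form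
  and `F ⊥ 1, v_j, ‖v‖²`, then both parts are orthogonal to `1, v_j, ‖v‖²` (the traceless class
  form is `γ`-orthogonal to `1, ‖ξ‖²` by `integral_classForm_mul_even`, the radial part to `ξ_j` by
  oddness; the remaining three reduced orthogonalities are read off from `F`).

The main certificate (`kcwuSharpPlus_of_kcwuSharp_of_kcwuSharpRadial`) is in
`…KCWUSharpPlusOfParts.lean`.
-/

noncomputable section

open MeasureTheory Set Filter ProbabilityTheory
open scoped ENNReal Topology

namespace Summit.AtomisticToContinuum.HydrodynamicLimit.Theorems.KineticCurrentsLDAlongFamiliesSketch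

open Literature.Analysis.FluidPDE (HardSphereFlow Config localMaxwellian)
open Literature.MathematicalPhysics.KineticTheory (T3 V3 hsDiameter localGibbsLaw)
open Literature.Analysis.FluidPDE Literature.MathematicalPhysics.KineticTheory
open KineticCurrentsWindowLDUniformSketch.ClassTruncation (integrable_of_le_lin integral_quad_weight
  integral_classForm_mul_even integral_mul_localMaxwellian_shift norm_shift_sq_eq norm_shift_sq_le
  classForm_shift)
open KineticFluxLdDecayTilt (integral_eq_zero_of_odd_stdGaussian)

namespace PlusOfParts

/-! ### Pointwise algebra of the split at a base point `u` -/

section Pointwise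

variable (A : Fin 3 → Fin 3 → ℝ) (b u : V3) (G K : ℝ → ℝ)

/-- Values of an enlarged-class functional on the two axis points `u ± r e_j`: the odd part
cancels in the sum, the quadratic form contributes its diagonal entry. [folklore] -/
theorem axis_values {F : V3 → ℝ}
    (hF : ∀ v, F v = (∑ j, ∑ k, A j k * ((v - u) j * (v - u) k)) +
      (∑ j, b j * (v - u) j) * G (‖v - u‖ ^ 2) + K (‖v - u‖ ^ 2)) (r : ℝ) (j : Fin 3) :
    F (u + r • EuclideanSpace.single j 1) + F (u - r • EuclideanSpace.single j 1) =
      2 * (A j j * r ^ 2) + 2 * K (r ^ 2) := by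
  have hn : ‖(r • EuclideanSpace.single j (1 : ℝ) : V3)‖ ^ 2 = r ^ 2 := by
    rw [norm_smul, EuclideanSpace.single, PiLp.norm_single, Real.norm_eq_abs, norm_one, mul_one,
      sq_abs]
  have hn' : ‖(-(r • EuclideanSpace.single j (1 : ℝ)) : V3)‖ ^ 2 = r ^ 2 := by rw [norm_neg, hn]
  have e1 : u + r • EuclideanSpace.single j (1 : ℝ) - u = r • EuclideanSpace.single j 1 :=
    add_sub_cancel_left _ _
  have e2 : u - r • EuclideanSpace.single j (1 : ℝ) - u = -(r • EuclideanSpace.single j 1) := by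
    abel
  rw [hF, hF, e1, e2, hn, hn']
  simp [Finset.sum_ite_eq', mul_ite, ite_mul]
  ring

/-- **The radial part from six axis values**:
`K(r²) + (tr A/3) r² = (1/6) Σ_j (F(u + r e_j) + F(u − r e_j))`. [folklore] -/
theorem radialProfile_eq {F : V3 → ℝ}
    (hF : ∀ v, F v = (∑ j, ∑ k, A j k * ((v - u) j * (v - u) k)) +
      (∑ j, b j * (v - u) j) * G (‖v - u‖ ^ 2) + K (‖v - u‖ ^ 2)) (r : ℝ) :
    K (r ^ 2) + (∑ j, A j j) / 3 * r ^ 2 =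
      6⁻¹ * ∑ j, (F (u + r • EuclideanSpace.single j 1) + F (u - r • EuclideanSpace.single j 1)) := by
  simp only [axis_values A b u G K hF, Fin.sum_univ_three]
  ring

/-- **Growth of the radial part**: `|K(ρ) + (tr A/3) ρ| ≤ C (1 + 2U² + 2ρ)` for `ρ ≥ 0`, from the
growth `|F(v)| ≤ C(1+‖v‖²)` at the six axis points `u ± √ρ e_j` (`‖u‖ ≤ U`). [folklore] -/
theorem abs_radialProfile_le {F : V3 → ℝ}
    (hF : ∀ v, F v = (∑ j, ∑ k, A j k * ((v - u) j * (v - u) k)) +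
      (∑ j, b j * (v - u) j) * G (‖v - u‖ ^ 2) + K (‖v - u‖ ^ 2))
    {C : ℝ} (hFg : ∀ v, |F v| ≤ C * (1 + ‖v‖ ^ 2)) {U : ℝ} (hU : ‖u‖ ≤ U) {ρ : ℝ} (hρ : 0 ≤ ρ) :
    |K ρ + (∑ j, A j j) / 3 * ρ| ≤ C * (1 + 2 * U ^ 2 + 2 * ρ) := by
  have hC : 0 ≤ C := by
    have h := (abs_nonneg _).trans (hFg u)
    nlinarith [sq_nonneg ‖u‖]
  set r := Real.sqrt ρ with hr
  have hr2 : r ^ 2 = ρ := Real.sq_sqrt hρ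
  have hpt : ∀ (j : Fin 3) (s : ℝ), s = r ∨ s = -r →
      |F (u + s • EuclideanSpace.single j 1)| ≤ C * (1 + 2 * U ^ 2 + 2 * ρ) := by
    intro j s hs
    refine (hFg _).trans (mul_le_mul_of_nonneg_left ?_ hC)
    have hns : ‖(s • EuclideanSpace.single j (1 : ℝ) : V3)‖ = |s| := by
      rw [norm_smul, EuclideanSpace.single, PiLp.norm_single, Real.norm_eq_abs, norm_one, mul_one]
    have habs : |s| ^ 2 = ρ := by
      rcases hs with h | h <;> simp [h, sq_abs, hr2]
    have h1 : ‖u + s • EuclideanSpace.single j (1 : ℝ)‖ ≤ ‖u‖ + |s| :=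
      (norm_add_le _ _).trans (by rw [hns])
    have h2 : ‖u + s • EuclideanSpace.single j (1 : ℝ)‖ ^ 2 ≤ 2 * ‖u‖ ^ 2 + 2 * |s| ^ 2 := by
      nlinarith [norm_nonneg (u + s • EuclideanSpace.single j (1 : ℝ)), norm_nonneg u,
        abs_nonneg s, sq_nonneg (‖u‖ - |s|)]
    have h3 : ‖u‖ ^ 2 ≤ U ^ 2 := pow_le_pow_left₀ (norm_nonneg _) hU 2
    nlinarith
  have hsum : |∑ j : Fin 3, (F (u + r • EuclideanSpace.single j 1) +
      F (u - r • EuclideanSpace.single j 1))| ≤ 6 * (C * (1 + 2 * U ^ 2 + 2 * ρ)) := by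
    have hsub : ∀ j : Fin 3, u - r • EuclideanSpace.single j (1 : ℝ) =
        u + (-r) • EuclideanSpace.single j 1 := fun j => by rw [neg_smul, sub_eq_add_neg]
    refine (Finset.abs_sum_le_sum_abs _ _).trans ?_
    have hb : ∀ j ∈ (Finset.univ : Finset (Fin 3)), |F (u + r • EuclideanSpace.single j 1) +
        F (u - r • EuclideanSpace.single j 1)| ≤ 2 * (C * (1 + 2 * U ^ 2 + 2 * ρ)) := by
      intro j _
      refine (abs_add_le _ _).trans ?_
      rw [hsub]
      linarith [hpt j r (Or.inl rfl), hpt j (-r) (Or.inr rfl)]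
    refine (Finset.sum_le_sum hb).trans ?_
    simp only [Finset.sum_const, Finset.card_univ, Fintype.card_fin, nsmul_eq_mul, Nat.cast_ofNat]
    linarith
  rw [← hr2, radialProfile_eq A b u G K hF r, abs_mul, abs_of_pos (by norm_num : (0 : ℝ) < 6⁻¹), hr2]
  linarith

end Pointwise

/-! ### Reduced Gaussian orthogonality (`v = u + √θ ξ`) -/

section Gauss

/-- **From reduced to Maxwellian orthogonality.** If `H(u + √θ ξ) = h(ξ)` with `h` Gaussian-integrable
against `1, ξ_j, ‖ξ‖²` and `γ`-orthogonal to them, then `H ⊥ 1, v_j, ‖v‖²` under `M_{1,u,θ}(v) dv`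
(`v_j = u_j + √θ ξ_j`, `‖v‖² = ‖u‖² + 2√θ (u·ξ) + θ‖ξ‖²`). [folklore] -/
theorem maxwellian_orth_of_reduced {θ : ℝ} (hθ : 0 < θ) (u : V3) {H : V3 → ℝ} {h : V3 → ℝ}
    (hsh : ∀ ξ, H (u + Real.sqrt θ • ξ) = h ξ)
    (hi0 : Integrable h (stdGaussian V3))
    (hi1 : ∀ j, Integrable (fun ξ => h ξ * ξ j) (stdGaussian V3))
    (hi2 : Integrable (fun ξ => h ξ * ‖ξ‖ ^ 2) (stdGaussian V3))
    (h0 : ∫ ξ, h ξ ∂stdGaussian V3 = 0) (h1 : ∀ j, ∫ ξ, h ξ * ξ j ∂stdGaussian V3 = 0)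
    (h2 : ∫ ξ, h ξ * ‖ξ‖ ^ 2 ∂stdGaussian V3 = 0) :
    (∫ v, H v * localMaxwellian 1 θ u v = 0) ∧
      (∀ j, ∫ v, H v * v j * localMaxwellian 1 θ u v = 0) ∧
      ∫ v, H v * ‖v‖ ^ 2 * localMaxwellian 1 θ u v = 0 := by
  refine ⟨?_, fun j => ?_, ?_⟩
  · rw [integral_mul_localMaxwellian_shift hθ u H]
    simp only [hsh]
    exact h0
  · rw [integral_mul_localMaxwellian_shift hθ u (fun v => H v * v j)]
    simp only [hsh, PiLp.add_apply, PiLp.smul_apply, smul_eq_mul]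
    have e : (fun ξ : V3 => h ξ * (u j + Real.sqrt θ * ξ j)) = fun ξ =>
        u j * h ξ + Real.sqrt θ * (h ξ * ξ j) := by
      funext ξ; ring
    rw [e, integral_add (hi0.const_mul _) ((hi1 j).const_mul _), integral_const_mul,
      integral_const_mul, h0, h1 j, mul_zero, mul_zero, add_zero]
  · rw [integral_mul_localMaxwellian_shift hθ u (fun v => H v * ‖v‖ ^ 2)]
    simp only [hsh, norm_shift_sq_eq hθ.le]
    have e : (fun ξ : V3 => h ξ *
        (‖u‖ ^ 2 + 2 * Real.sqrt θ * (∑ j, u j * ξ j) + θ * ‖ξ‖ ^ 2)) = fun ξ =>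
        ‖u‖ ^ 2 * h ξ + 2 * Real.sqrt θ * (∑ j, u j * (h ξ * ξ j)) + θ * (h ξ * ‖ξ‖ ^ 2) := by
      funext ξ; simp only [Fin.sum_univ_three]; ring
    have his : Integrable (fun ξ : V3 => ∑ j, u j * (h ξ * ξ j)) (stdGaussian V3) :=
      integrable_finsetSum _ fun j _ => (hi1 j).const_mul _
    have hA : Integrable (fun ξ : V3 => ‖u‖ ^ 2 * h ξ +
        2 * Real.sqrt θ * (∑ j, u j * (h ξ * ξ j))) (stdGaussian V3) :=
      (hi0.const_mul _).add (his.const_mul _)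
    rw [e, integral_add hA (hi2.const_mul _), integral_add (hi0.const_mul _) (his.const_mul _),
      integral_const_mul, integral_const_mul, integral_const_mul,
      integral_finsetSum _ fun j _ => (hi1 j).const_mul _]
    simp [integral_const_mul, h0, h1, h2]

/-- **From Maxwellian to reduced orthogonality** (converse bookkeeping: `√θ > 0`). [folklore] -/
theorem reduced_orth_of_maxwellian {θ : ℝ} (hθ : 0 < θ) (u : V3) {H : V3 → ℝ} {h : V3 → ℝ}
    (hsh : ∀ ξ, H (u + Real.sqrt θ • ξ) = h ξ)
    (hi0 : Integrable h (stdGaussian V3))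
    (hi1 : ∀ j, Integrable (fun ξ => h ξ * ξ j) (stdGaussian V3))
    (hi2 : Integrable (fun ξ => h ξ * ‖ξ‖ ^ 2) (stdGaussian V3))
    (H0 : ∫ v, H v * localMaxwellian 1 θ u v = 0)
    (H1 : ∀ j, ∫ v, H v * v j * localMaxwellian 1 θ u v = 0)
    (H2 : ∫ v, H v * ‖v‖ ^ 2 * localMaxwellian 1 θ u v = 0) :
    (∫ ξ, h ξ ∂stdGaussian V3 = 0) ∧ (∀ j, ∫ ξ, h ξ * ξ j ∂stdGaussian V3 = 0) ∧
      ∫ ξ, h ξ * ‖ξ‖ ^ 2 ∂stdGaussian V3 = 0 := by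
  have hs : 0 < Real.sqrt θ := Real.sqrt_pos.2 hθ
  have h0 : ∫ ξ, h ξ ∂stdGaussian V3 = 0 := by
    rw [integral_mul_localMaxwellian_shift hθ u H] at H0
    simpa only [hsh] using H0
  have h1 : ∀ j, ∫ ξ, h ξ * ξ j ∂stdGaussian V3 = 0 := by
    intro j
    have Hj := H1 j
    rw [integral_mul_localMaxwellian_shift hθ u (fun v => H v * v j)] at Hj
    simp only [hsh, PiLp.add_apply, PiLp.smul_apply, smul_eq_mul] at Hj
    have e : (fun ξ : V3 => h ξ * (u j + Real.sqrt θ * ξ j)) = fun ξ =>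
        u j * h ξ + Real.sqrt θ * (h ξ * ξ j) := by
      funext ξ; ring
    rw [e, integral_add (hi0.const_mul _) ((hi1 j).const_mul _), integral_const_mul,
      integral_const_mul, h0, mul_zero, zero_add] at Hj
    rcases mul_eq_zero.1 Hj with h' | h'
    · exact absurd h' hs.ne'
    · exact h'
  refine ⟨h0, h1, ?_⟩
  have HE := H2
  rw [integral_mul_localMaxwellian_shift hθ u (fun v => H v * ‖v‖ ^ 2)] at HE
  simp only [hsh, norm_shift_sq_eq hθ.le] at HE
  have e : (fun ξ : V3 => h ξ *
      (‖u‖ ^ 2 + 2 * Real.sqrt θ * (∑ j, u j * ξ j) + θ * ‖ξ‖ ^ 2)) = fun ξ =>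
      ‖u‖ ^ 2 * h ξ + 2 * Real.sqrt θ * (∑ j, u j * (h ξ * ξ j)) + θ * (h ξ * ‖ξ‖ ^ 2) := by
    funext ξ; simp only [Fin.sum_univ_three]; ring
  have his : Integrable (fun ξ : V3 => ∑ j, u j * (h ξ * ξ j)) (stdGaussian V3) :=
    integrable_finsetSum _ fun j _ => (hi1 j).const_mul _
  have hA : Integrable (fun ξ : V3 => ‖u‖ ^ 2 * h ξ +
      2 * Real.sqrt θ * (∑ j, u j * (h ξ * ξ j))) (stdGaussian V3) :=
    (hi0.const_mul _).add (his.const_mul _)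
  rw [e, integral_add hA (hi2.const_mul _), integral_add (hi0.const_mul _) (his.const_mul _),
    integral_const_mul, integral_const_mul, integral_const_mul,
    integral_finsetSum _ fun j _ => (hi1 j).const_mul _] at HE
  simp only [integral_const_mul, h0, h1, mul_zero, Finset.sum_const_zero, add_zero, zero_add] at HE
  rcases mul_eq_zero.1 HE with h' | h'
  · exact absurd h' hθ.ne'
  · exact h'

/-- **Orthogonality of the two parts of the split.** At a base point `(u, θ)`: if
`F = F₁ + k₂(‖· − u‖²)` with `F₁` a structured class form with TRACELESS matrix `A₀` and `F` orthogonal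
to `1, v_j, ‖v‖²` under `M_{1,u,θ}`, then both `F₁` and the radial part are orthogonal to
`1, v_j, ‖v‖²` (the traceless class form is `γ`-orthogonal to `1, ‖ξ‖²` by
`integral_classForm_mul_even`, the radial part to `ξ_j` by oddness; the rest is read off from `F`).
Growth hypotheses are in the reduced variable and only serve integrability. [folklore] -/
theorem split_orth {θ : ℝ} (hθ : 0 < θ) (u : V3) (A₀ : Fin 3 → Fin 3 → ℝ) (htr : ∑ j, A₀ j j = 0)
    (b : V3) (G k₂ : ℝ → ℝ) (hk₂ : Continuous k₂)
    {F F₁ : V3 → ℝ} (hFc : Continuous F)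
    (hF₁ : ∀ v, F₁ v = (∑ j, ∑ k, A₀ j k * ((v - u) j * (v - u) k)) +
      (∑ j, b j * (v - u) j) * G (‖v - u‖ ^ 2))
    (hsplit : ∀ v, F v = F₁ v + k₂ (‖v - u‖ ^ 2))
    {P : ℝ} (hFg : ∀ ξ : V3, |F (u + Real.sqrt θ • ξ)| ≤ P * (1 + ‖ξ‖ ^ 2))
    {Q : ℝ} (hk₂g : ∀ ξ : V3, |k₂ (θ * ‖ξ‖ ^ 2)| ≤ Q * (1 + ‖ξ‖ ^ 2))
    (H0 : ∫ v, F v * localMaxwellian 1 θ u v = 0)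
    (H1 : ∀ j, ∫ v, F v * v j * localMaxwellian 1 θ u v = 0)
    (H2 : ∫ v, F v * ‖v‖ ^ 2 * localMaxwellian 1 θ u v = 0) :
    ((∫ v, F₁ v * localMaxwellian 1 θ u v = 0) ∧
      (∀ j, ∫ v, F₁ v * v j * localMaxwellian 1 θ u v = 0) ∧
      ∫ v, F₁ v * ‖v‖ ^ 2 * localMaxwellian 1 θ u v = 0) ∧
    ((∫ v, k₂ (‖v - u‖ ^ 2) * localMaxwellian 1 θ u v = 0) ∧
      (∀ j, ∫ v, k₂ (‖v - u‖ ^ 2) * v j * localMaxwellian 1 θ u v = 0) ∧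
      ∫ v, k₂ (‖v - u‖ ^ 2) * ‖v‖ ^ 2 * localMaxwellian 1 θ u v = 0) := by
  set s := Real.sqrt θ with hs_def
  have hs : s * s = θ := Real.mul_self_sqrt hθ.le
  -- the three reduced functions
  set hF : V3 → ℝ := fun ξ => F (u + s • ξ) with hF_def
  set h₂ : V3 → ℝ := fun ξ => k₂ (θ * ‖ξ‖ ^ 2) with h₂_def
  have hnorm : ∀ ξ : V3, ‖u + s • ξ - u‖ ^ 2 = θ * ‖ξ‖ ^ 2 := fun ξ => by
    rw [add_sub_cancel_left, norm_smul, mul_pow, Real.norm_eq_abs, sq_abs, sq, hs]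
  have hsh₂ : ∀ ξ : V3, k₂ (‖u + s • ξ - u‖ ^ 2) = h₂ ξ := fun ξ => by rw [hnorm]
  have hsh₁ : ∀ ξ : V3, F₁ (u + s • ξ) = hF ξ - h₂ ξ := fun ξ => by
    simp only [hF_def, hsplit, hsh₂]; ring
  -- the class form of `F₁` in the reduced variable
  have hform : ∀ ξ : V3, hF ξ - h₂ ξ =
      θ * (∑ j, ∑ k, A₀ j k * (ξ j * ξ k)) * (fun _ : ℝ => (1 : ℝ)) (‖ξ‖ ^ 2) +
        Real.sqrt θ * (∑ j, b j * ξ j) * (fun t : ℝ => G (θ * t)) (‖ξ‖ ^ 2) := by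
    intro ξ
    have e := classForm_shift hs u A₀ b (fun _ => (1 : ℝ)) G ξ
    simp only [one_mul, mul_one] at e
    rw [← hsh₁, hF₁, e]
    simp only [mul_one, hs_def]
  -- integrability
  have hFc' : Continuous hF := hFc.comp (continuous_const.add (continuous_id.const_smul s))
  have h₂c : Continuous h₂ := hk₂.comp (continuous_const.mul (continuous_norm.pow 2))
  obtain ⟨iF0, iF1, iF2⟩ := integrable_of_le_lin (h := hF) hFc' hFg
  obtain ⟨i20, i21, i22⟩ := integrable_of_le_lin (h := h₂) h₂c hk₂g
  -- reduced orthogonality of `F`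
  obtain ⟨rF0, rF1, rF2⟩ := reduced_orth_of_maxwellian hθ u (H := F) (h := hF) (fun ξ => rfl)
    iF0 iF1 iF2 H0 H1 H2
  -- integrability of the reduced `F₁ = hF - h₂` against `1, ξ_j, ‖ξ‖²`
  have i10 : Integrable (fun ξ => hF ξ - h₂ ξ) (stdGaussian V3) := iF0.sub i20
  have i11 : ∀ j, Integrable (fun ξ : V3 => (hF ξ - h₂ ξ) * ξ j) (stdGaussian V3) := fun j =>
    ((iF1 j).sub (i21 j)).congr (ae_of_all _ fun ξ => by simp only [Pi.sub_apply]; ring)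
  have i12 : Integrable (fun ξ : V3 => (hF ξ - h₂ ξ) * ‖ξ‖ ^ 2) (stdGaussian V3) :=
    (iF2.sub i22).congr (ae_of_all _ fun ξ => by simp only [Pi.sub_apply]; ring)
  -- `F₁ ⊥ 1, ‖ξ‖²` in the reduced variable (traceless class form)
  have E1 : ∫ ξ, (hF ξ - h₂ ξ) ∂stdGaussian V3 = 0 := by
    have h := integral_classForm_mul_even (h := fun ξ => hF ξ - h₂ ξ) (θ := θ) (A := A₀) (b := b)
      (κ := fun _ => (1 : ℝ)) (lam := fun t => G (θ * t)) (ϖ := fun _ => (1 : ℝ)) hform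
      continuous_const (P := 1) (fun s hs0 => by simp only [mul_one, abs_one]; linarith)
      (by simpa only [mul_one] using i10)
    simp only [mul_one, htr, mul_zero, zero_mul] at h
    exact h
  have E2 : ∫ ξ, (hF ξ - h₂ ξ) * ‖ξ‖ ^ 2 ∂stdGaussian V3 = 0 := by
    have h := integral_classForm_mul_even (h := fun ξ => hF ξ - h₂ ξ) (θ := θ) (A := A₀) (b := b)
      (κ := fun _ => (1 : ℝ)) (lam := fun t => G (θ * t)) (ϖ := fun t => t) hform
      (by simpa only [one_mul] using (continuous_id' : Continuous fun t : ℝ => t)) (P := 1)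
      (fun s hs0 => by rw [one_mul, abs_of_nonneg hs0]; linarith) i12
    simp only [htr, mul_zero, zero_mul] at h
    exact h
  -- radial part `⊥ ξ_j` by oddness
  have R1 : ∀ j, ∫ ξ, h₂ ξ * ξ j ∂stdGaussian V3 = 0 := fun j =>
    integral_eq_zero_of_odd_stdGaussian fun ξ => by
      simp only [h₂_def, norm_neg, PiLp.neg_apply, mul_neg]
  -- the remaining reduced orthogonalities, read off from `F = F₁ + F₂`
  have R0 : ∫ ξ, h₂ ξ ∂stdGaussian V3 = 0 := by
    have e : (fun ξ => h₂ ξ) = fun ξ => hF ξ - (hF ξ - h₂ ξ) := by funext ξ; ring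
    rw [e, integral_sub iF0 i10, rF0, E1, sub_zero]
  have O1 : ∀ j, ∫ ξ, (hF ξ - h₂ ξ) * ξ j ∂stdGaussian V3 = 0 := by
    intro j
    have e : (fun ξ : V3 => (hF ξ - h₂ ξ) * ξ j) = fun ξ => hF ξ * ξ j - h₂ ξ * ξ j := by
      funext ξ; ring
    rw [e, integral_sub (iF1 j) (i21 j), rF1 j, R1 j, sub_zero]
  have R2 : ∫ ξ, h₂ ξ * ‖ξ‖ ^ 2 ∂stdGaussian V3 = 0 := by
    have e : (fun ξ : V3 => h₂ ξ * ‖ξ‖ ^ 2) = fun ξ =>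
        hF ξ * ‖ξ‖ ^ 2 - (hF ξ - h₂ ξ) * ‖ξ‖ ^ 2 := by
      funext ξ; ring
    rw [e, integral_sub iF2 i12, rF2, E2, sub_zero]
  refine ⟨?_, ?_⟩
  · exact maxwellian_orth_of_reduced hθ u (H := F₁) (h := fun ξ => hF ξ - h₂ ξ) hsh₁
      i10 i11 i12 E1 O1 E2
  · exact maxwellian_orth_of_reduced hθ u (H := fun v => k₂ (‖v - u‖ ^ 2)) (h := h₂) hsh₂
      i20 i21 i22 R0 R1 R2

end Gauss

end PlusOfParts

/-- **Registered form of `PlusOfParts.split_orth`** (sub-goal `stub_plusSplitOrth` of crux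
stmt-AtomisticToContinuum-16659, line `Sketch`): orthogonality to `1, v_j, ‖v‖²` of BOTH parts of the
split of an enlarged-class functional at one base point, all binders explicit. [folklore] -/
theorem stub_plusSplitOrth :
    ∀ (θ : ℝ), 0 < θ → ∀ (u : V3) (A₀ : Fin 3 → Fin 3 → ℝ), ∑ j, A₀ j j = 0 →
      ∀ (b : V3) (G k₂ : ℝ → ℝ), Continuous k₂ → ∀ (F F₁ : V3 → ℝ), Continuous F →
      (∀ v, F₁ v = (∑ j, ∑ k, A₀ j k * ((v - u) j * (v - u) k)) +
        (∑ j, b j * (v - u) j) * G (‖v - u‖ ^ 2)) →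
      (∀ v, F v = F₁ v + k₂ (‖v - u‖ ^ 2)) →
      ∀ (P : ℝ), (∀ ξ : V3, |F (u + Real.sqrt θ • ξ)| ≤ P * (1 + ‖ξ‖ ^ 2)) →
      ∀ (Q : ℝ), (∀ ξ : V3, |k₂ (θ * ‖ξ‖ ^ 2)| ≤ Q * (1 + ‖ξ‖ ^ 2)) →
      (∫ v, F v * localMaxwellian 1 θ u v = 0) →
      (∀ j, ∫ v, F v * v j * localMaxwellian 1 θ u v = 0) →
      (∫ v, F v * ‖v‖ ^ 2 * localMaxwellian 1 θ u v = 0) →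
      ((∫ v, F₁ v * localMaxwellian 1 θ u v = 0) ∧
        (∀ j, ∫ v, F₁ v * v j * localMaxwellian 1 θ u v = 0) ∧
        ∫ v, F₁ v * ‖v‖ ^ 2 * localMaxwellian 1 θ u v = 0) ∧
      ((∫ v, k₂ (‖v - u‖ ^ 2) * localMaxwellian 1 θ u v = 0) ∧
        (∀ j, ∫ v, k₂ (‖v - u‖ ^ 2) * v j * localMaxwellian 1 θ u v = 0) ∧
        ∫ v, k₂ (‖v - u‖ ^ 2) * ‖v‖ ^ 2 * localMaxwellian 1 θ u v = 0) :=
  fun _θ hθ u A₀ htr b G k₂ hk₂ _F _F₁ hFc hF₁ hsplit _P hFg _Q hk₂g H0 H1 H2 =>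
    PlusOfParts.split_orth hθ u A₀ htr b G k₂ hk₂ hFc hF₁ hsplit hFg hk₂g H0 H1 H2

end Summit.AtomisticToContinuum.HydrodynamicLimit.Theorems.KineticCurrentsLDAlongFamiliesSketch

end
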